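import Summits.ValiantsHypothesis.ValiantsHypothesis.Theorems.FifoMatchingNNDivisionHardLocalizationCubeSpecies

/-!
# FifoMatching · NNDivisionHard — localization, part 11: §B6 WEIGHTED PINS (s2′) and the HULL CLOSURE

Theorems-grade port (bytes staged by val-idea-43 g6 for a port hand) of §B6 of the crux workfile `Cruxes/NNDivisionHard/Symmetry43.lean`
REV 4 (val-idea-43 g6; crux `stmt-ValiantsHypothesis-21181` `FifoMatching.NNDivisionHard`; filed under crit-9 g3 V#106 / desk #417 «(s1)/(s2)
strengthenings at leisure» — no new species number) — statements and proofs VERBATIM, namespace `…Theorems.FifoMatching.Localization`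
(imports part 10 `…LocalizationCubeSpecies` for `OmegaInjTop`; uses part 9 `Outside` / `pinOff` / `exists_generic_outside`, part 8
`faceQuiet_of_twoScaleTop`, part 7 `faceQuiet_decided`, part 1 `corVirtualHard_of_residualLaw`, part 4 `residualLaw_anti`).

* (s2′) WEIGHTED PINS: `IsWPin ι w₀` (zero on `Ω = ι × ι`, entrywise `≤ 0`, strictly negative on the off-`ι` diagonal) ⇒ valid with bound `0`
  (`IsWPin.corVec_le`), tight set `{b ⊆ ι}` (`IsWPin.tight`, `IsWPin.free`), blind to second scales outside `Ω` (`IsWPin.outside`);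
  `isWPin_pinOff`; ★ `faceQuiet_of_wpinTop_injOn` (an `Ω`-injective `w₀`-top layer ⇒ `Face Quiet`), `dotProduct_eq_of_agree_outside` (top layers
  are unions of `Ω`-fibres of the off-`Ω` shadow), class `WPinInjTop ⊇ OmegaInjTop` (`omegaInjTop_le_wPinInjTop`), ★★ `wPinInjTop_decided`.
  Enemy clause (E-5′) therefore quantifies over the whole cone of weighted pins, for every `ι` and in every rooting / switching.
* HULL CLOSURE: `Hull X` (some family in `X` has the same convex hull), `le_hull`, `hull_mono`, `hull_hull_le`, ★★ `decided_hull` /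
  `decidedB_hull` (`Decided` only speaks about `conv (range q)`), `residualLaw_hull_of`, glue ★★★ `corVirtualHard_of_residualLawHull`,
  `hull_of_sandwich` (`range q ⊆ range q' ⊆ conv (range q)`), `hull_of_range_eq`.  BOOKKEEPING: «residual» becomes a property of the polytope.

Honest label: instance theorems + bookkeeping for the TOP cone; NOT progress on `C′ = ExactPencilLaw` nor on `CoreLawOrb`; 0 explicit residual
members before and after; 21181 OPEN; VP ≠ VNP NOT proved.
-/

set_option linter.unusedVariables false
set_option linter.unusedSectionVars false
set_option linter.dupNamespace false

namespace Summit.ValiantsHypothesis.ValiantsHypothesis.Theorems.FifoMatching.Localization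

open Matrix Finset
open scoped Pointwise
open Literature.Barriers.PneNP (HasEFOfSize)
open Literature.Combinatorics.Optimization (corPolytopeGraph corVec)

/-! ### weighted off-`Ω` pins -/

/-- `w₀` is a WEIGHTED PIN for `ι`: zero on `Ω = ι × ι`, entrywise nonpositive, strictly negative on the off-`ι` diagonal. -/
structure IsWPin {h ℓ : ℕ} (ι : Fin ℓ ↪ Fin h) (w₀ : Fin h × Fin h → ℝ) : Prop where
  inside : ∀ p, ¬ Outside ι p → w₀ p = 0
  nonpos : ∀ p, w₀ p ≤ 0
  diag : ∀ k, (∀ a, ι a ≠ k) → w₀ (k, k) < 0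

/-- vectors supported outside `Ω` vanish on the `corVec`s of the sets inside `ι`. -/
theorem outside_dotProduct_corVec_eq_zero {h ℓ : ℕ} (ι : Fin ℓ ↪ Fin h) (v : Fin h × Fin h → ℝ)
    (hv : ∀ p, ¬ Outside ι p → v p = 0) (b : Fin h → Bool) (hb : ∀ k, (∀ a, ι a ≠ k) → b k = false) :
    v ⬝ᵥ corVec (⊤ : SimpleGraph (Fin h)) b = 0 := by
  unfold dotProduct
  refine Finset.sum_eq_zero fun p _ => ?_
  by_cases hp : Outside ι p
  · rcases hp with h1 | h1
    · rw [show p = (p.1, p.2) from rfl, corVec_top_eq_zero_of_fst b p.2 (hb p.1 h1), mul_zero]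
    · rw [show p = (p.1, p.2) from rfl, corVec_top_eq_zero_of_snd b p.1 (hb p.2 h1), mul_zero]
  · rw [hv p hp, zero_mul]

/-- a weighted pin is VALID with bound `0`, … -/
theorem IsWPin.corVec_le {h ℓ : ℕ} {ι : Fin ℓ ↪ Fin h} {w₀ : Fin h × Fin h → ℝ} (hw : IsWPin ι w₀) (b : Fin h → Bool) :
    w₀ ⬝ᵥ corVec (⊤ : SimpleGraph (Fin h)) b ≤ 0 :=
  Finset.sum_nonpos fun p _ => mul_nonpos_iff.mpr (Or.inr ⟨hw.nonpos p, corVec_top_nonneg b p⟩)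

/-- … TIGHT only on the `b` vanishing off `ι`, … -/
theorem IsWPin.tight {h ℓ : ℕ} {ι : Fin ℓ ↪ Fin h} {w₀ : Fin h × Fin h → ℝ} (hw : IsWPin ι w₀) (b : Fin h → Bool)
    (hb : w₀ ⬝ᵥ corVec (⊤ : SimpleGraph (Fin h)) b = 0) (k : Fin h) (hk : ∀ a, ι a ≠ k) : b k = false := by
  have hterm : w₀ (k, k) * corVec (⊤ : SimpleGraph (Fin h)) b (k, k) = 0 :=
    (Finset.sum_eq_zero_iff_of_nonpos fun p _ =>
      mul_nonpos_iff.mpr (Or.inr ⟨hw.nonpos p, corVec_top_nonneg b p⟩)).mp hb (k, k) (Finset.mem_univ _)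
  have hkk : corVec (⊤ : SimpleGraph (Fin h)) b (k, k) = 0 :=
    (mul_eq_zero.mp hterm).resolve_left (ne_of_lt (hw.diag k hk))
  rw [corVec_top_apply] at hkk
  cases hbk : b k
  · rfl
  · rw [hbk, Bool.and_self, if_pos rfl] at hkk
    exact absurd hkk one_ne_zero

/-- … FREE on `ι` (extend by `0`), … -/
theorem IsWPin.free {h ℓ : ℕ} {ι : Fin ℓ ↪ Fin h} {w₀ : Fin h × Fin h → ℝ} (hw : IsWPin ι w₀) (c : Fin ℓ → Bool) :
    ∃ b : Fin h → Bool, w₀ ⬝ᵥ corVec (⊤ : SimpleGraph (Fin h)) b = 0 ∧ b ∘ ι = c := by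
  refine ⟨Function.extend ι c (fun _ => false), outside_dotProduct_corVec_eq_zero ι w₀ hw.inside _ fun k hk => ?_, ?_⟩
  · rw [Function.extend_apply' _ _ _ (fun ⟨a, ha⟩ => hk a ha)]
  · funext a
    exact ι.injective.extend_apply _ _ a

/-- … and BLIND to second scales supported outside `Ω` on its tight set. -/
theorem IsWPin.outside {h ℓ : ℕ} {ι : Fin ℓ ↪ Fin h} {w₀ : Fin h × Fin h → ℝ} (hw : IsWPin ι w₀) (v : Fin h × Fin h → ℝ)
    (hv : ∀ p, ¬ Outside ι p → v p = 0) (b : Fin h → Bool) (hb : w₀ ⬝ᵥ corVec (⊤ : SimpleGraph (Fin h)) b = 0) :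
    v ⬝ᵥ corVec (⊤ : SimpleGraph (Fin h)) b = 0 :=
  outside_dotProduct_corVec_eq_zero ι v hv b (hw.tight b hb)

/-- the unit diagonal pins `pinOff ι` are a weighted pin. -/
theorem isWPin_pinOff {h ℓ : ℕ} (ι : Fin ℓ ↪ Fin h) : IsWPin ι (pinOff ι) := by
  classical
  refine ⟨fun p hp => ?_, fun p => ?_, fun k hk => ?_⟩
  · unfold pinOff stableFun
    rw [if_neg]
    intro hmem
    exact hp (Or.inl (Finset.mem_filter.mp hmem).2.2)
  · unfold pinOff stableFun
    split_ifs <;> norm_num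
  · unfold pinOff stableFun
    rw [if_pos (Finset.mem_filter.mpr ⟨Finset.mem_univ _, rfl, hk⟩)]
    norm_num

/-- ★ **WEIGHTED-PIN Ω-INJECTIVE TOP LAYERS ∈ `Face Quiet`** ((s2′)): if for some weighted pin `w₀` of `ι` (`⌊√h⌋ ≤ ℓ`) two points of
the `w₀`-top layer that agree OUTSIDE `Ω` are equal, then `q ∈ Face Quiet`. -/
theorem faceQuiet_of_wpinTop_injOn {h ℓ K : ℕ} (q : Fam h K) (hℓ : Nat.sqrt h ≤ ℓ) (ι : Fin ℓ ↪ Fin h)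
    (w₀ : Fin h × Fin h → ℝ) (hw : IsWPin ι w₀)
    (hinj : ∀ j j', (∀ k, w₀ ⬝ᵥ q k ≤ w₀ ⬝ᵥ q j) → (∀ k, w₀ ⬝ᵥ q k ≤ w₀ ⬝ᵥ q j') →
      (∀ p, Outside ι p → q j p = q j' p) → q j = q j') :
    Face Quiet h K q := by
  classical
  let G : Fin (K + 1) × Fin (K + 1) → (Fin h × Fin h → ℝ) := fun jj => q jj.1 - q jj.2
  obtain ⟨v, hv0, hvG⟩ := exists_generic_outside ι
    (Finset.univ.filter fun jj : Fin (K + 1) × Fin (K + 1) => ∃ p, Outside ι p ∧ G jj p ≠ 0) G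
    (fun jj hjj => (Finset.mem_filter.mp hjj).2)
  have hv : ∀ b : Fin h → Bool, w₀ ⬝ᵥ corVec (⊤ : SimpleGraph (Fin h)) b = 0 →
      v ⬝ᵥ corVec (⊤ : SimpleGraph (Fin h)) b = 0 := hw.outside v hv0
  obtain ⟨j₁, -, hj₁⟩ := Finset.exists_max_image Finset.univ (fun j => w₀ ⬝ᵥ q j) Finset.univ_nonempty
  let Tl : Finset (Fin (K + 1)) := Finset.univ.filter fun j => ∀ k, w₀ ⬝ᵥ q k ≤ w₀ ⬝ᵥ q j
  have hTl : Tl.Nonempty := ⟨j₁, Finset.mem_filter.mpr ⟨Finset.mem_univ _, fun k => hj₁ k (Finset.mem_univ k)⟩⟩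
  obtain ⟨j₀, hj₀T, hj₀⟩ := Finset.exists_max_image Tl (fun j => v ⬝ᵥ q j) hTl
  have hj₀top : ∀ k, w₀ ⬝ᵥ q k ≤ w₀ ⬝ᵥ q j₀ := (Finset.mem_filter.mp hj₀T).2
  refine faceQuiet_of_twoScaleTop q hℓ ι w₀ v 0 0 hw.corVec_le hw.free hv j₀ fun j => ?_
  rcases (hj₀top j).lt_or_eq with hlt | heqW
  · exact Or.inl (Or.inl hlt)
  have hjtop : ∀ k, w₀ ⬝ᵥ q k ≤ w₀ ⬝ᵥ q j := fun k => (hj₀top k).trans_eq heqW.symm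
  have hjT : j ∈ Tl := Finset.mem_filter.mpr ⟨Finset.mem_univ _, hjtop⟩
  rcases (hj₀ j hjT).lt_or_eq with hlt | heqV
  · exact Or.inl (Or.inr ⟨heqW, hlt⟩)
  refine Or.inr (hinj j j₀ hjtop hj₀top fun p hp => ?_)
  by_contra hne
  have hmem : (j, j₀) ∈ Finset.univ.filter
      (fun jj : Fin (K + 1) × Fin (K + 1) => ∃ p, Outside ι p ∧ G jj p ≠ 0) :=
    Finset.mem_filter.mpr ⟨Finset.mem_univ _, p, hp, fun h0 => hne (sub_eq_zero.mp h0)⟩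
  have h1 := hvG (j, j₀) hmem
  rw [dotProduct_sub, heqV, sub_self] at h1
  exact h1 rfl

/-- the top layer of a functional supported outside `Ω` is a union of `Ω`-FIBRES of the off-`Ω` shadow: points agreeing outside `Ω`
have the same `w₀`-value. -/
theorem dotProduct_eq_of_agree_outside {h ℓ : ℕ} (ι : Fin ℓ ↪ Fin h) (w₀ : Fin h × Fin h → ℝ)
    (hw : ∀ p, ¬ Outside ι p → w₀ p = 0) (y y' : Fin h × Fin h → ℝ) (hyy : ∀ p, Outside ι p → y p = y' p) :
    w₀ ⬝ᵥ y = w₀ ⬝ᵥ y' := by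
  unfold dotProduct
  refine Finset.sum_congr rfl fun p _ => ?_
  by_cases hp : Outside ι p
  · rw [hyy p hp]
  · rw [hw p hp, zero_mul, zero_mul]

/-- the WEIGHTED-PIN Ω-INJECTIVE-TOP class ((s2′) as a class). -/
def WPinInjTop : PClass := fun h K q =>
  ∃ ℓ : ℕ, Nat.sqrt h ≤ ℓ ∧ ∃ ι : Fin ℓ ↪ Fin h, ∃ w₀ : Fin h × Fin h → ℝ, IsWPin ι w₀ ∧
    ∀ j j', (∀ k, w₀ ⬝ᵥ q k ≤ w₀ ⬝ᵥ q j) → (∀ k, w₀ ⬝ᵥ q k ≤ w₀ ⬝ᵥ q j') → (∀ p, Outside ι p → q j p = q j' p) → q j = q j'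

/-- `OmegaInjTop ⊆ WPinInjTop` (`w₀ = pinOff ι`). -/
theorem omegaInjTop_le_wPinInjTop {h K : ℕ} {q : Fam h K} (hq : OmegaInjTop h K q) : WPinInjTop h K q := by
  obtain ⟨ℓ, hℓ, ι, hinj⟩ := hq
  exact ⟨ℓ, hℓ, ι, pinOff ι, isWPin_pinOff ι, hinj⟩

/-- ★★ **WEIGHTED-PIN Ω-INJECTIVE TOPS ARE DECIDED.** -/
theorem wPinInjTop_decided : Decided WPinInjTop :=
  decided_anti (fun _ _ q ⟨_, hℓ, ι, w₀, hw, hinj⟩ => faceQuiet_of_wpinTop_injOn q hℓ ι w₀ hw hinj) faceQuiet_decided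

/-! ### the hull closure -/

/-- the HULL CLOSURE of a class: some family in `X` has the same convex hull. -/
def Hull (X : PClass) : PClass := fun h K q =>
  ∃ (K' : ℕ) (q' : Fam h K'), X h K' q' ∧ convexHull ℝ (Set.range q') = convexHull ℝ (Set.range q)

/-- `X ⊆ Hull X`. -/
theorem le_hull (X : PClass) {h K : ℕ} {q : Fam h K} (hq : X h K q) : Hull X h K q := ⟨K, q, hq, rfl⟩

/-- `Hull` is monotone. -/
theorem hull_mono {X Y : PClass} (hXY : ∀ h K (q : Fam h K), X h K q → Y h K q) {h K : ℕ} {q : Fam h K}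
    (hq : Hull X h K q) : Hull Y h K q := by
  obtain ⟨K', q', hq', hh⟩ := hq
  exact ⟨K', q', hXY _ _ _ hq', hh⟩

/-- `Hull` is idempotent. -/
theorem hull_hull_le (X : PClass) {h K : ℕ} {q : Fam h K} (hq : Hull (Hull X) h K q) : Hull X h K q := by
  obtain ⟨K', q', ⟨K'', q'', hq'', hh''⟩, hh'⟩ := hq
  exact ⟨K'', q'', hq'', hh''.trans hh'⟩

/-- ★★ **THE HULL CLOSURE OF A DECIDED CLASS IS DECIDED** (`Decided` only speaks about `conv (range q)`). -/
theorem decided_hull {X : PClass} (hX : Decided X) : Decided (Hull X) := by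
  intro c
  obtain ⟨h₀, hh₀⟩ := hX c
  refine ⟨h₀, fun h hh K q r ⟨K', q', hq', hhull⟩ hEF => hh₀ h hh K' q' r hq' ?_⟩
  rwa [hhull]

/-- `DecidedB` version. -/
theorem decidedB_hull {X : PClass} (hX : DecidedB X) : DecidedB (Hull X) := by
  intro c
  obtain ⟨h₀, hh₀⟩ := hX c
  refine ⟨h₀, fun h hh K q r ⟨K', q', hq', hhull⟩ hB hEF => hh₀ h hh K' q' r hq' ?_ ?_⟩
  · rwa [hhull]
  · rwa [hhull]

/-- the weaker research stub: the residual law outside the hull closure. -/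
theorem residualLaw_hull_of {X : PClass} (hR : ResidualLaw X) : ResidualLaw (Hull X) :=
  residualLaw_anti (fun _ _ _ hq => le_hull X hq) hR

/-- ★★★ **GLUE (hull form)**: it suffices to prove the residual law for budgeted POLYTOPES none of whose presentations is in `X`. -/
theorem corVirtualHard_of_residualLawHull {X : PClass} (hX : Decided X) (hR : ResidualLaw (Hull X)) : CorVirtualHard :=
  corVirtualHard_of_residualLaw (decided_hull hX) hR

/-- the cheap sufficient condition for a common hull: `range q ⊆ range q' ⊆ conv (range q)`. -/
theorem hull_of_sandwich {X : PClass} {h K K' : ℕ} {q : Fam h K} {q' : Fam h K'} (hq' : X h K' q')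
    (h₁ : Set.range q ⊆ Set.range q') (h₂ : Set.range q' ⊆ convexHull ℝ (Set.range q)) : Hull X h K q :=
  ⟨K', q', hq', Set.Subset.antisymm (convexHull_min h₂ (convex_convexHull ℝ _)) (convexHull_mono h₁)⟩

/-- in particular a RE-INDEXED family (same point set) is in the hull closure. -/
theorem hull_of_range_eq {X : PClass} {h K K' : ℕ} {q : Fam h K} {q' : Fam h K'} (hq' : X h K' q')
    (hr : Set.range q' = Set.range q) : Hull X h K q :=
  ⟨K', q', hq', by rw [hr]⟩

end Summit.ValiantsHypothesis.ValiantsHypothesis.Theorems.FifoMatching.Localization
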